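import Mathlib
import Summits.NavierStokesRegularity.NavierStokesRegularity.Theorems.ThreadingFluxHorizonTowerFiniteTowerTopPairSplit3
import HarnessLib

/-!
# Crux `PoloidalLiouville` (stmt-NavierStokesRegularity-1222), crux idea «horizon-threading-tower» (ns-idea-15):
# FINITE TOWERS AT ORDER ONE — THE CLASS POLYNOMIAL SPLIT TO LEVEL `N − 6` (the fourth digit's pairs)

Support file (`--supports stmt-NavierStokesRegularity-1222`, helper; cell `ns-wall-extremal`, width hand ns-wall-eng-3 g7; 0 kit), toward
THM K «gcd-2 top pair WITH the competitor shell `D′ − 2` AND the shell `D′ − 4`, in general degree» (`FiniteTowerGcdTwoTwoShellsHorizonTowerZonality`).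

★ `finiteTower_topPair_mod_normSq_pow_four`: in a finite scale-free tower annihilated by the order-one horizon law off the centre, with an
EVEN top pair `D′ < D` (`D′ + 2 ≤ D`, `D′ ≥ 6`) and no two odd shells of degree sum `D + D′ − 6`, the class polynomial of level
`N = D + D′` (which vanishes, `finiteTower_classPoly_eq_zero`) reads, with `c = D′ − 2`, `b = D′ − 4`, `b₆ = D′ − 6`, `λ_j = j(j+1)` and
`P̃_l = P_l` if `l ∈ K`, else `0`,
`2(λ_{D′} − λ_D){P_{D′},P_D} + ρ·2(λ_c − λ_D){P̃_c,P_D} + ρ²·(2(λ_b − λ_D){P̃_b,P_D} + e₁{P̃_c,P_{D′}})`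
`  + ρ³·(2(λ_{b₆} − λ_D){P̃_{b₆},P_D} + e₂{P̃_b,P_{D′}} + e₃{P̃_c,P_{D′}}) + ρ⁴·R = 0`,
with `e₁ = e₂ = 0` unless `D = D′ + 2` and `e₃ = 0` unless `D = D′ + 4`: the pairs on levels `N`, `N − 2`, `N − 4`, `N − 6` are exactly
`(D′,D)`, `(c,D)`, `(b,D)` & `(c,D′)` [iff `D = D′+2`], `(b₆,D)` & `(b,D′)` [iff `D = D′+2`] & `(c,D′)` [iff `D = D′+4`] (plus diagonal pairs,
coefficient zero, and the excluded odd pair `(D′−3, D′−1)`); everything else enters at `ρ⁴`.  This is `…TopPairSplit3` (p727387, level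
`N − 4`) one level deeper, same bookkeeping (`sum_sum_ite_pair`).

HONEST LABEL: bookkeeping about one crux idea's typed objects; no Prop of the sketch is closed here; `HorizonTowerZonality` (general
towers), `PoloidalLiouville` (1222) OPEN; NS regularity NOT proved.  [folklore]
-/

-- the summit and its single sub-problem share the name (CONVENTIONS §1)
set_option linter.dupNamespace false
-- `simp only` closers over `C`-coefficients are import-order sensitive (simprocs); keep the lists explicit, silence the arg linter
set_option linter.unusedSimpArgs false

noncomputable section

open MvPolynomial
open scoped RealInnerProductSpace

namespace Summit.NavierStokesRegularity.NavierStokesRegularity.Theorems.PoloidalLiouville.HorizonTower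

section FiniteTower

variable (K : Finset ℕ) (H : ℕ → E3 → ℝ)

set_option maxHeartbeats 800000 in
/-- ★ **THE CLASS POLYNOMIAL SPLIT TO LEVEL `N − 6`.**  Even top pair `D′ < D` with `D′ + 2 ≤ D`, `c + 2 = D′`, `b + 4 = D′`,
`b₆ + 6 = D′`, no two odd shells of degree sum `D + D′ − 6`; `P̃_l := P_l` if `l ∈ K` else `0`.  Then for some reals `e₁ e₂` (zero unless
`D = D′ + 2`), `e₃` (zero unless `D = D′ + 4`) and some polynomial `R`:
`2(λ_{D′}−λ_D){P_{D′},P_D} + ρ·2(λ_c−λ_D){P̃_c,P_D} + ρ²(2(λ_b−λ_D){P̃_b,P_D} + e₁{P̃_c,P_{D′}})`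
`+ ρ³(2(λ_{b₆}−λ_D){P̃_{b₆},P_D} + e₂{P̃_b,P_{D′}} + e₃{P̃_c,P_{D′}}) + ρ⁴R = 0`. [folklore] -/
theorem finiteTower_topPair_mod_normSq_pow_four (hK : ∀ l ∈ K, 1 ≤ l) (hH : ∀ l ∈ K, ContDiff ℝ (⊤ : ℕ∞) (H l))
    (hhom : ∀ l ∈ K, ∀ (c : ℝ) (y : E3), H l (c • y) = c ^ l * H l y)
    (hharm : ∀ l ∈ K, ∀ y, Laplacian.laplacian (H l) y = 0)
    (hL1 : ∀ x : E3, x ≠ 0 → horizonL1 (fun z => ∑ l ∈ K, horizonProfile l (H l) 0 z) 0 x = 0)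
    (P : ℕ → MvPolynomial (Fin 3) ℝ) (hP : ∀ l ∈ K, ∀ y, H l y = Zonal.evalE (P l) y)
    {D D' c b b₆ : ℕ} (hD : D ∈ K) (hD' : D' ∈ K) (hDD : D' + 2 ≤ D) (hDpar : D % 2 = 0) (hD'par : D' % 2 = 0)
    (hc : c + 2 = D') (hb : b + 4 = D') (hb₆ : b₆ + 6 = D')
    (hmax : ∀ l ∈ K, l ≤ D) (hsec : ∀ l ∈ K, l ≠ D → l ≤ D')
    (hodd : ∀ j ∈ K, ∀ k ∈ K, j % 2 = 1 → k % 2 = 1 → j + k + 6 ≠ D + D') :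
    ∃ (e₁ e₂ e₃ : ℝ) (R : MvPolynomial (Fin 3) ℝ), (D ≠ D' + 2 → e₁ = 0) ∧ (D ≠ D' + 2 → e₂ = 0) ∧ (D ≠ D' + 4 → e₃ = 0) ∧
      C (2 * ((D' : ℝ) * (D' + 1) - (D : ℝ) * (D + 1))) * Zonal.detP (P D') (P D)
        + Zonal.normSq * (C (2 * ((c : ℝ) * (c + 1) - (D : ℝ) * (D + 1))) * Zonal.detP (if c ∈ K then P c else 0) (P D))
        + Zonal.normSq ^ 2 * (C (2 * ((b : ℝ) * (b + 1) - (D : ℝ) * (D + 1))) * Zonal.detP (if b ∈ K then P b else 0) (P D)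
          + C e₁ * Zonal.detP (if c ∈ K then P c else 0) (P D'))
        + Zonal.normSq ^ 3 * (C (2 * ((b₆ : ℝ) * (b₆ + 1) - (D : ℝ) * (D + 1))) * Zonal.detP (if b₆ ∈ K then P b₆ else 0) (P D)
          + C e₂ * Zonal.detP (if b ∈ K then P b else 0) (P D') + C e₃ * Zonal.detP (if c ∈ K then P c else 0) (P D'))
        + Zonal.normSq ^ 4 * R = 0 := by
  classical
  set N : ℕ := D + D' with hN
  set ρ : MvPolynomial (Fin 3) ℝ := X 0 ^ 2 + X 1 ^ 2 + X 2 ^ 2 with hρ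
  have hρeq : (Zonal.normSq : MvPolynomial (Fin 3) ℝ) = ρ := rfl
  -- coefficient function and its antisymmetry
  set lam : ℕ → ℕ → ℝ := fun j k => (j : ℝ) * (j + 1) - (k : ℝ) * (k + 1) with hlam
  have hlam_anti : ∀ j k, lam k j = -lam j k := by intro j k; simp only [hlam]; ring
  -- the class polynomial vanishes
  have hQ := finiteTower_classPoly_eq_zero K H hK hH hhom hharm hL1 P hP N (by
    intro j hj k hk hjk
    have hjD := hmax j hj
    have hkD := hmax k hk
    have : j = D ∧ k = D := by
      constructor
      · by_contra h; have := hsec j hj h; omega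
      · by_contra h; have := hsec k hk h; omega
    rw [this.1, this.2, Zonal.detP_self'])
  -- the summand and its decomposition by levels
  set t : ℕ → ℕ → MvPolynomial (Fin 3) ℝ := fun j k =>
    if j + k ≤ N ∧ (j + k) % 2 = N % 2 then C (lam j k) * (ρ ^ ((N - (j + k)) / 2) * Zonal.detP (P j) (P k)) else 0 with ht
  set pt : ℕ → ℕ → ℕ → ℕ → MvPolynomial (Fin 3) ℝ := fun p q j k =>
    if j = p ∧ k = q then C (lam p q) * Zonal.detP (P p) (P q) else 0 with hpt
  set eN : ℝ := if D = D' + 2 then 1 else 0 with heN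
  set eN4 : ℝ := if D = D' + 4 then 1 else 0 with heN4
  set r : ℕ → ℕ → MvPolynomial (Fin 3) ℝ := fun j k =>
    if j + k + 8 ≤ N ∧ (j + k) % 2 = N % 2 then C (lam j k) * (ρ ^ ((N - (j + k)) / 2 - 4) * Zonal.detP (P j) (P k)) else 0
    with hr
  have hpt_of : ∀ p q j k, j = p → k = q → pt p q j k = C (lam j k) * Zonal.detP (P j) (P k) := by
    intro p q j k hj hk; subst hj; subst hk; simp [hpt]
  have hpt_ne : ∀ p q j k, (j = p → k ≠ q) → pt p q j k = 0 := by
    intro p q j k h; simp only [hpt]; rw [if_neg (fun hh => h hh.1 hh.2)]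
  have hterm : ∀ j ∈ K, ∀ k ∈ K, t j k
      = (pt D' D j k + pt D D' j k)
        + ρ * (pt c D j k + pt D c j k)
        + ρ ^ 2 * ((pt b D j k + pt D b j k) + C eN * (pt c D' j k + pt D' c j k))
        + ρ ^ 3 * ((pt b₆ D j k + pt D b₆ j k) + C eN * (pt b D' j k + pt D' b j k) + C eN4 * (pt c D' j k + pt D' c j k))
        + ρ ^ 4 * r j k := by
    intro j hj k hk
    have hjD := hmax j hj
    have hkD := hmax k hk
    have hjs : j ≠ D → j ≤ D' := hsec j hj
    have hks : k ≠ D → k ≤ D' := hsec k hk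
    have hne := fun p q (h : j = p → k ≠ q) => hpt_ne p q j k h
    simp only [ht, hr]
    by_cases hcond : j + k ≤ N ∧ (j + k) % 2 = N % 2
    · rw [if_pos hcond]
      rcases Nat.lt_or_ge (j + k + 7) N with hlow | hhigh
      · -- `j + k + 8 ≤ N`: remainder
        have h8 : j + k + 8 ≤ N := by omega
        rw [if_pos ⟨h8, hcond.2⟩, hne D' D (by omega), hne D D' (by omega), hne c D (by omega), hne D c (by omega),
          hne b D (by omega), hne D b (by omega), hne b₆ D (by omega), hne D b₆ (by omega)]
        obtain ⟨q, hq⟩ : ∃ q, (N - (j + k)) / 2 = q + 4 := ⟨(N - (j + k)) / 2 - 4, by omega⟩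
        rw [hq, Nat.add_sub_cancel, pow_add]
        by_cases hD2 : D = D' + 2
        · rw [hne c D' (by omega), hne D' c (by omega), hne b D' (by omega), hne D' b (by omega)]
          have heN40 : eN4 = 0 := by simp [heN4, hD2]
          rw [heN40, map_zero]
          ring
        · have heN0 : eN = 0 := by simp [heN, hD2]
          rw [heN0, map_zero]
          by_cases hD4 : D = D' + 4
          · rw [hne c D' (by omega), hne D' c (by omega)]
            ring
          · have heN40 : eN4 = 0 := by simp [heN4, hD4]
            rw [heN40, map_zero]
            ring
      · -- by parity `j + k ∈ {N, N − 2, N − 4, N − 6}`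
        have hr0 : ¬(j + k + 8 ≤ N ∧ (j + k) % 2 = N % 2) := fun h => by omega
        rw [if_neg hr0, mul_zero, add_zero]
        have hcases : j + k = N ∨ j + k + 2 = N ∨ j + k + 4 = N ∨ j + k + 6 = N := by omega
        rcases hcases with hs | hs | hs | hs
        · -- level `N`: the top pair
          rw [hne c D (by omega), hne D c (by omega), hne b D (by omega), hne D b (by omega), hne c D' (by omega),
            hne D' c (by omega), hne b₆ D (by omega), hne D b₆ (by omega), hne b D' (by omega), hne D' b (by omega),
            show (N - (j + k)) / 2 = 0 by omega, pow_zero, one_mul]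
          rcases eq_or_ne k D with rfl | hkne
          · have hj' : j = D' := by omega
            rw [hpt_of D' k j k hj' rfl, hne k D' (by omega)]
            simp only [mul_zero, add_zero]
          · have hk' := hks hkne
            rw [hne D' D (fun _ => hkne), hpt_of D D' j k (by omega) (by omega)]
            simp only [mul_zero, add_zero, zero_add]
        · -- level `N − 2`: the competitor against the top
          rw [hne D' D (by omega), hne D D' (by omega), hne b D (by omega), hne D b (by omega), hne c D' (by omega),
            hne D' c (by omega), hne b₆ D (by omega), hne D b₆ (by omega), hne b D' (by omega), hne D' b (by omega),
            show (N - (j + k)) / 2 = 1 by omega, pow_one]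
          rcases eq_or_ne k D with rfl | hkne
          · rw [hpt_of c k j k (by omega) rfl, hne k c (by omega)]
            simp only [mul_zero, add_zero, zero_add]
            ring
          · rcases eq_or_ne j D with rfl | hjne
            · rw [hne c j (fun _ => hkne), hpt_of j c j k rfl (by omega)]
              simp only [mul_zero, add_zero, zero_add]
              ring
            · -- both `≤ D′`: then `j = k = D′`, coefficient zero
              have hj' := hjs hjne
              have hk' := hks hkne
              have hjk : j = D' ∧ k = D' := by omega
              rw [hne c D (fun _ => hkne), hne D c (fun h => absurd h hjne), hjk.1, hjk.2]
              simp only [hlam, sub_self, map_zero, zero_mul, mul_zero, add_zero]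
        · -- level `N − 4`: the third digit's pairs
          rw [hne D' D (by omega), hne D D' (by omega), hne c D (by omega), hne D c (by omega), hne b₆ D (by omega),
            hne D b₆ (by omega), hne b D' (by omega), hne D' b (by omega), show (N - (j + k)) / 2 = 2 by omega]
          rcases eq_or_ne k D with rfl | hkne
          · rw [hpt_of b k j k (by omega) rfl, hne k b (by omega), hne c D' (by omega), hne D' c (by omega)]
            simp only [mul_zero, add_zero, zero_add]
            ring
          · rcases eq_or_ne j D with rfl | hjne
            · rw [hne b j (fun _ => hkne), hpt_of j b j k rfl (by omega), hne c D' (by omega), hne D' c (by omega)]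
              simp only [mul_zero, add_zero, zero_add]
              ring
            · have hj' := hjs hjne
              have hk' := hks hkne
              rw [hne b D (fun _ => hkne), hne D b (fun h => absurd h hjne)]
              by_cases hjk : j = k
              · subst hjk
                rw [hne c D' (by omega), hne D' c (by omega)]
                simp only [hlam, sub_self, map_zero, zero_mul, mul_zero, add_zero]
              · have hD2 : D = D' + 2 := by omega
                have heN1 : eN = 1 := by simp [heN, hD2]
                have heN40 : eN4 = 0 := by rw [heN4, if_neg (by omega)]
                rcases eq_or_ne k D' with rfl | hkne'
                · rw [hpt_of c k j k (by omega) rfl, hne k c (by omega), heN1, heN40]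
                  simp only [map_one, map_zero, mul_zero, zero_mul, add_zero, zero_add, one_mul]
                  ring
                · rw [hne c D' (fun _ => hkne'), hpt_of D' c j k (by omega) (by omega), heN1, heN40]
                  simp only [map_one, map_zero, mul_zero, zero_mul, add_zero, zero_add, one_mul]
                  ring
        · -- level `N − 6`: the fourth digit's pairs
          rw [hne D' D (by omega), hne D D' (by omega), hne c D (by omega), hne D c (by omega), hne b D (by omega),
            hne D b (by omega), show (N - (j + k)) / 2 = 3 by omega]
          rcases eq_or_ne k D with rfl | hkne
          · rw [hpt_of b₆ k j k (by omega) rfl, hne k b₆ (by omega), hne c D' (by omega), hne D' c (by omega),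
              hne b D' (by omega), hne D' b (by omega)]
            simp only [mul_zero, add_zero, zero_add]
            ring
          · rcases eq_or_ne j D with rfl | hjne
            · rw [hne b₆ j (fun _ => hkne), hpt_of j b₆ j k rfl (by omega), hne c D' (by omega), hne D' c (by omega),
                hne b D' (by omega), hne D' b (by omega)]
              simp only [mul_zero, add_zero, zero_add]
              ring
            · have hj' := hjs hjne
              have hk' := hks hkne
              rw [hne b₆ D (fun _ => hkne), hne D b₆ (fun h => absurd h hjne)]
              by_cases hjk : j = k
              · subst hjk
                rw [hne c D' (by omega), hne D' c (by omega), hne b D' (by omega), hne D' b (by omega)]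
                simp only [hlam, sub_self, map_zero, zero_mul, mul_zero, add_zero]
              · -- off-diagonal, both `≤ D′`: `D = D′ + 2` with `{j,k} = {b, D′}` (the odd pair is excluded), or `D = D′ + 4` with `{c, D′}`
                have hoddjk := hodd j hj k hk
                rcases eq_or_ne k D' with rfl | hkne'
                · by_cases hD2 : D = k + 2
                  · have heN1 : eN = 1 := by simp [heN, hD2]
                    rw [hpt_of b k j k (by omega) rfl, hne k b (by omega), hne c k (by omega), hne k c (by omega), heN1]
                    simp only [map_one, mul_zero, add_zero, zero_add, one_mul]
                    ring
                  · have hD4 : D = k + 4 := by omega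
                    have heN0 : eN = 0 := by simp [heN, hD2]
                    have heN41 : eN4 = 1 := by simp [heN4, hD4]
                    rw [hpt_of c k j k (by omega) rfl, hne k c (by omega), heN0, heN41]
                    simp only [map_one, map_zero, mul_zero, zero_mul, add_zero, zero_add, one_mul]
                    ring
                · rcases eq_or_ne j D' with rfl | hjne'
                  · by_cases hD2 : D = j + 2
                    · have heN1 : eN = 1 := by simp [heN, hD2]
                      rw [hne b j (fun _ => hkne'), hpt_of j b j k rfl (by omega), hne c j (fun _ => hkne'),
                        hne j c (by omega), heN1]
                      simp only [map_one, mul_zero, add_zero, zero_add, one_mul]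
                      ring
                    · have hD4 : D = j + 4 := by omega
                      have heN0 : eN = 0 := by simp [heN, hD2]
                      have heN41 : eN4 = 1 := by simp [heN4, hD4]
                      rw [hne c j (fun _ => hkne'), hpt_of j c j k rfl (by omega), heN0, heN41]
                      simp only [map_one, map_zero, mul_zero, zero_mul, add_zero, zero_add, one_mul]
                      ring
                  · -- neither is `D` nor `D′`: only the odd pair `(D′−3, D′−1)` fits, excluded by `hodd`
                    exfalso
                    have hj2 : j ≤ D' - 1 := by omega
                    have hk2 : k ≤ D' - 1 := by omega
                    by_cases hjo : j % 2 = 1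
                    · have hko : k % 2 = 1 := by omega
                      exact hoddjk hjo hko (by omega)
                    · omega
    · rw [if_neg hcond]
      have hr0 : ¬(j + k + 8 ≤ N ∧ (j + k) % 2 = N % 2) := fun h => hcond ⟨by omega, h.2⟩
      have hpar : ∀ p q, p + q ≤ N → (p + q) % 2 = N % 2 → (j = p → k ≠ q) := by
        rintro p q h1 h2 rfl rfl; exact hcond ⟨h1, h2⟩
      rw [if_neg hr0, hne D' D (hpar D' D (by omega) (by omega)), hne D D' (hpar D D' (by omega) (by omega)),
        hne c D (hpar c D (by omega) (by omega)), hne D c (hpar D c (by omega) (by omega)),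
        hne b D (hpar b D (by omega) (by omega)), hne D b (hpar D b (by omega) (by omega)),
        hne b₆ D (hpar b₆ D (by omega) (by omega)), hne D b₆ (hpar D b₆ (by omega) (by omega)),
        hne c D' (hpar c D' (by omega) (by omega)), hne D' c (hpar D' c (by omega) (by omega)),
        hne b D' (hpar b D' (by omega) (by omega)), hne D' b (hpar D' b (by omega) (by omega))]
      simp only [mul_zero, add_zero]
  -- sum of each piece
  have hsum_pt : ∀ p q, p ≠ q → (∑ j ∈ K, ∑ k ∈ K, (pt p q j k + pt q p j k))
      = if p ∈ K ∧ q ∈ K then C (2 * lam p q) * Zonal.detP (P p) (P q) else 0 := by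
    intro p q hpq
    simp only [Finset.sum_add_distrib, hpt]
    rw [sum_sum_ite_pair K p q, sum_sum_ite_pair K q p]
    by_cases h : p ∈ K ∧ q ∈ K
    · rw [if_pos h, if_pos ⟨h.2, h.1⟩, if_pos h, hlam_anti p q, Zonal.detP_antisymm (P p) (P q)]
      simp only [map_neg, map_mul, map_ofNat]
      ring
    · have h' : ¬(q ∈ K ∧ p ∈ K) := fun h2 => h ⟨h2.2, h2.1⟩
      rw [if_neg h, if_neg h', if_neg h, add_zero]
  have hsplit : (∑ j ∈ K, ∑ k ∈ K, t j k)
      = (∑ j ∈ K, ∑ k ∈ K, (pt D' D j k + pt D D' j k))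
        + ρ * (∑ j ∈ K, ∑ k ∈ K, (pt c D j k + pt D c j k))
        + ρ ^ 2 * ((∑ j ∈ K, ∑ k ∈ K, (pt b D j k + pt D b j k)) + C eN * (∑ j ∈ K, ∑ k ∈ K, (pt c D' j k + pt D' c j k)))
        + ρ ^ 3 * ((∑ j ∈ K, ∑ k ∈ K, (pt b₆ D j k + pt D b₆ j k)) + C eN * (∑ j ∈ K, ∑ k ∈ K, (pt b D' j k + pt D' b j k))
          + C eN4 * (∑ j ∈ K, ∑ k ∈ K, (pt c D' j k + pt D' c j k)))
        + ρ ^ 4 * ∑ j ∈ K, ∑ k ∈ K, r j k := by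
    rw [Finset.sum_congr rfl (fun j hj => Finset.sum_congr rfl (fun k hk => hterm j hj k hk))]
    simp only [Finset.sum_add_distrib, Finset.mul_sum, mul_add]
  have h0 : (∑ j ∈ K, ∑ k ∈ K, t j k) = 0 := hQ
  rw [hsplit, hsum_pt D' D (by omega), hsum_pt c D (by omega), hsum_pt b D (by omega), hsum_pt c D' (by omega),
    hsum_pt b₆ D (by omega), hsum_pt b D' (by omega), if_pos ⟨hD', hD⟩] at h0
  refine ⟨if D = D' + 2 then (if c ∈ K then 2 * lam c D' else 0) else 0,
    if D = D' + 2 then (if b ∈ K then 2 * lam b D' else 0) else 0,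
    if D = D' + 4 then (if c ∈ K then 2 * lam c D' else 0) else 0, ∑ j ∈ K, ∑ k ∈ K, r j k, ?_, ?_, ?_, ?_⟩
  · intro hne; rw [if_neg hne]
  · intro hne; rw [if_neg hne]
  · intro hne; rw [if_neg hne]
  rw [hρeq]
  -- identify the indicator sums with the `P̃` brackets
  have hdet0 : ∀ Q : MvPolynomial (Fin 3) ℝ, Zonal.detP 0 Q = 0 := fun Q => by
    rw [← C_0, Zonal.detP_C_left, C_0]
  have hone : ∀ (p : ℕ) (Q : MvPolynomial (Fin 3) ℝ), (if p ∈ K ∧ D ∈ K then C (2 * lam p D) * Zonal.detP (P p) Q else 0)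
      = C (2 * lam p D) * Zonal.detP (if p ∈ K then P p else 0) Q := by
    intro p Q
    by_cases h : p ∈ K
    · rw [if_pos ⟨h, hD⟩, if_pos h]
    · rw [if_neg (fun h2 => h h2.1), if_neg h, hdet0, mul_zero]
  have htwo : ∀ (p a : ℕ) (ind : ℝ) (hind : ind = if D = D' + a then 1 else 0) (Q : MvPolynomial (Fin 3) ℝ),
      C ind * (if p ∈ K ∧ D' ∈ K then C (2 * lam p D') * Zonal.detP (P p) Q else 0)
      = C (if D = D' + a then (if p ∈ K then 2 * lam p D' else 0) else 0) * Zonal.detP (if p ∈ K then P p else 0) Q := by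
    intro p a ind hind Q
    by_cases h2 : D = D' + a
    · have h1 : ind = 1 := by rw [hind, if_pos h2]
      rw [h1, if_pos h2, map_one, one_mul]
      by_cases h : p ∈ K
      · rw [if_pos ⟨h, hD'⟩, if_pos h, if_pos h]
      · rw [if_neg (fun h3 => h h3.1), if_neg h, if_neg h, hdet0, mul_zero]
    · have h1 : ind = 0 := by rw [hind, if_neg h2]
      rw [h1, if_neg h2, map_zero, zero_mul, zero_mul]
  rw [hone c, hone b, hone b₆, htwo c 2 eN heN, htwo b 2 eN heN, htwo c 4 eN4 heN4] at h0
  simp only [hlam] at h0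
  exact h0

end FiniteTower

end Summit.NavierStokesRegularity.NavierStokesRegularity.Theorems.PoloidalLiouville.HorizonTower

end
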